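import Mathlib.Data.ZMod.Basic
import Mathlib.Data.Nat.GCD.Basic
import Mathlib.Tactic.LinearCombination
import Mathlib.Tactic.Ring
import Mathlib.Tactic.Linarith
import Mathlib.Tactic.IntervalCases
import HarnessLib

/-!
# Venture HSemireg — the general-seed transport formula and the norm-form tables behind THEOREM LINE-DIOPHANTINE
# (ENGINE-W PROBE5 §13–§15; `LINE-DIOPHANTINE-CARD-A.md` §2–§4) — kernel arithmetic

HONEST FRAMING. Lean index of the computation cell `pub-hsemireg`, widening group ENGINE-W (code A, seat `engine-w-1`,
gen 16). RING IDENTITIES AND FINITE ARITHMETIC ONLY: the `SL₂(ℤ)`-word bookkeeping of a quadratic node and the primitive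
representability of small integers by the norm forms `x² + |m|y²`; no Mukai vector, autoequivalence, abelian variety, sheaf,
`Ext` group or semiregularity map is constructed; nothing here says that HC, HC_CM or HC_AV holds. Theorems only (0 `def`,
0 named fact, 0 `sorry`).

SOURCE (the cell's own results): `widen/ENGINE-W/out/probe5/LINE-DIOPHANTINE-CARD-A.md` v1.9 (consolidating PROBE5-STIZ-A.md
§13–§20; file of record v4.9k `d984e355a7a98c81`). §2 «GENERAL-SEED TRANSPORT FORMULA: for a split seed with nodes `λ, λ̄`
(`T = λ + λ̄`, `D = λλ̄ ∈ ℤ`) and a factor word `γ = [[α,β],[γ′,δ]] ∈ SL₂(ℤ)`: new node `μ(λ) = (a + λ)∕N(z)`,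
`a = αγ′ + β(γ′T + δD)`, `z = α + βλ`, `N(z) = α² + αβT + β²D` (proof: `(γ′+δλ)(α+βλ̄) = a + (αδ−βγ′)λ`)». §3 THEOREM
LINE-DIOPHANTINE (iii): «`c` is PRIMITIVELY represented by the norm form of the seed's own order in `k′`: `c = x² − m·y²`
(`ℤ[√m]`-type seed) …, `gcd(x,y) = 1`» and «(`m ≡ 1 (mod 4)` and `c = 2`: both sides fail for the `ℤ[√m]`-seed — THEOREM R1-ℤ =
«`x² − y² ≢ 2 (mod 4)`»)». §4 TABLES: «R1 PROPER (`c = 2`), `ℤ[√m]`-seeds: imaginary fields `ℚ(i)`, `ℚ(√−2)` ONLY»; «Lines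
`(1⁵,c)`, `2 ≤ c ≤ 48`, `ℤ[√m]`-seeds: `ℚ(i)` {2,5,10,13,17,25,26,29,34,37,41}; `ℚ(√−2)` {2,3,6,9,11,17,18,19,22,27,33,34,38,41,43};
`ℚ(√−7)` {7,8,11,16,23,29,32,37,43} …». Tier at source: transport formula pencil + machine ×2 across codes (44 predicted
transports each class-exact where predicted); tables = rigorous decisions (exact). What the kernel holds:

* §1 `transport_numerator`, `norm_z`, **`transport_node`** — the three identities of §2 in any commutative ring with `λ² = Tλ − D`
  (`linear_combination`), and the node formula `(γ′ + δλ)·N(z) = (a + λ)·(α + βλ)`… in the form «numerator × conjugate».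
* §2 **`sq_sub_sq_ne_two_mod_four`** (THEOREM R1-ℤ's core: `x² − y² ≢ 2 (mod 4)`), `norm_ne_two_of_one_mod_four`
  (`m ≡ 1 (mod 4)` ⟹ `x² − m y² ≠ 2` over `ℤ`).
* §3 **`two_repr_iff`** (R1 PROPER over imaginary node fields: `x² + n·y² = 2` with `n ≥ 1`, `(x,y)` primitive ⟺ `n ≤ 2`),
  and the three `(1⁵, c)` tables for `ℚ(i)`, `ℚ(√−2)`, `ℚ(√−7)` (`2 ≤ c ≤ 48`) as DECIDED finite statements
  (`lineTable_one`, `lineTable_two`, `lineTable_seven`: membership in the printed list ⟺ a primitive representation exists; `decide`).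
WHAT IS NOT HERE: the equivalence (i) ⟺ (iii) itself (STI-ℤ, LEMMA 𝔞_c, LEMMA ∥ — PROBE5 §13–§14), the real-field tables
(indefinite forms: the NO side is not a bounded search), the O-type seed.
-/

namespace Summit.Ventures.HSemireg.LineDiophantine

/-! ## §1 The general-seed transport formula (`λ² = Tλ − D`, `λ̄ = T − λ`) -/

/-- **`(γ′ + δλ)(α + βλ̄) = a + (αδ − βγ′)λ`** with `a = αγ′ + β(γ′T + δD)`, `λ̄ = T − λ`, in any commutative ring in which
`λ² = Tλ − D` (LINE-DIOPHANTINE card §2, «proof»). [kernel] -/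
theorem transport_numerator {R : Type*} [CommRing R] (l T D α β γ' δ : R) (hl : l ^ 2 = T * l - D) :
    (γ' + δ * l) * (α + β * (T - l)) = (α * γ' + β * (γ' * T + δ * D)) + (α * δ - β * γ') * l := by
  linear_combination (-(β * δ)) * hl

/-- **`N(z) = (α + βλ)(α + βλ̄) = α² + αβT + β²D`** (card §2). [kernel] -/
theorem norm_z {R : Type*} [CommRing R] (l T D α β : R) (hl : l ^ 2 = T * l - D) :
    (α + β * l) * (α + β * (T - l)) = α ^ 2 + α * β * T + β ^ 2 * D := by
  linear_combination (-(β ^ 2)) * hl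

/-- **The new node**: for `αδ − βγ′ = 1`, `(γ′ + δλ)·(α + βλ̄) = a + λ`; hence, in the fraction field,
`μ(λ) = (γ′ + δλ)∕(α + βλ) = (a + λ)∕N(z)` («new node `μ(λ) = (a + λ)∕N(z)`»). Stated multiplicatively (no division):
`(γ′ + δλ)·(α + βλ̄) = a + λ` and `(α + βλ)(α + βλ̄) = N(z)`. [kernel] -/
theorem transport_node {R : Type*} [CommRing R] (l T D α β γ' δ : R) (hl : l ^ 2 = T * l - D)
    (hdet : α * δ - β * γ' = 1) :
    (γ' + δ * l) * (α + β * (T - l)) = (α * γ' + β * (γ' * T + δ * D)) + l := by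
  rw [transport_numerator l T D α β γ' δ hl, hdet, one_mul]

/-! ## §2 THEOREM R1-ℤ's congruence: `x² − y² ≢ 2 (mod 4)` -/

/-- **`x² − y² ≢ 2 (mod 4)`** (squares are `0, 1 (mod 4)`). [kernel, `decide` in `ZMod 4`] -/
theorem sq_sub_sq_ne_two_mod_four (x y : ZMod 4) : x ^ 2 - y ^ 2 ≠ 2 := by
  revert x y
  decide

/-- Hence for `m ≡ 1 (mod 4)` the norm form of `ℤ[√m]` never takes the value `2`: `x² − m·y² ≠ 2` for all integers `x, y`
(«`m ≡ 1 (mod 4)` and `c = 2`: both sides fail for the `ℤ[√m]`-seed»; «never `m ≡ 1 (mod 4)`» in the R1 PROPER table). [kernel] -/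
theorem norm_ne_two_of_one_mod_four (m x y : ℤ) (hm : m % 4 = 1) : x ^ 2 - m * y ^ 2 ≠ 2 := by
  intro h
  have hc : ((x ^ 2 - m * y ^ 2 : ℤ) : ZMod 4) = (2 : ℤ) := by rw [h]
  obtain ⟨k, hk⟩ : ∃ k, m = 4 * k + 1 := ⟨m / 4, by omega⟩
  subst hk
  have h4 : (4 : ZMod 4) = 0 := by decide
  push_cast at hc
  rw [h4, zero_mul, zero_add, one_mul] at hc
  exact sq_sub_sq_ne_two_mod_four _ _ hc

/-! ## §3 Imaginary node fields: R1 PROPER and the `(1⁵, c)` tables as decided finite statements -/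

/-- **R1 PROPER over imaginary node fields** (`m = −n < 0`, `ℤ[√m]`-seed, `c = 2`): `2 = x² + n·y²` has a solution with
`(x, y)` coprime iff `n ≤ 2` — «imaginary fields `ℚ(i)`, `ℚ(√−2)` ONLY» (`1 + 1 = 2`, `0 + 2·1 = 2`; for `n ≥ 3`, `y = 0` forces
`x² = 2`). [kernel] -/
theorem two_repr_iff (n : ℕ) (hn : 1 ≤ n) :
    (∃ x y : ℕ, x ^ 2 + n * y ^ 2 = 2 ∧ Nat.gcd x y = 1) ↔ n ≤ 2 := by
  constructor
  · rintro ⟨x, y, hxy, hg⟩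
    by_contra hlt
    push Not at hlt
    have hy : y = 0 := by
      by_contra hy0
      have : 1 ≤ y ^ 2 := Nat.one_le_pow _ _ (Nat.pos_of_ne_zero hy0)
      nlinarith
    subst hy
    simp at hg
    subst hg
    simp at hxy
  · intro hle
    interval_cases n
    · exact ⟨1, 1, by norm_num, by norm_num⟩
    · exact ⟨0, 1, by norm_num, by norm_num⟩

/-- **Line table for `ℚ(i)`** (card §4: «`ℚ(i)` {2,5,10,13,17,25,26,29,34,37,41}», `2 ≤ c ≤ 48`): `c` is primitively represented
by `x² + y²` exactly for the listed `c` (bounded search is complete: `x, y ≤ 6`). [kernel, `decide`] -/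
theorem lineTable_one :
    ∀ c ∈ Finset.Icc 2 48,
      (c ∈ ({2, 5, 10, 13, 17, 25, 26, 29, 34, 37, 41} : Finset ℕ) ↔
        ∃ x ∈ Finset.range 7, ∃ y ∈ Finset.range 7, x ^ 2 + y ^ 2 = c ∧ Nat.gcd x y = 1) := by
  decide

/-- **Line table for `ℚ(√−2)`** (card §4: «`ℚ(√−2)` {2,3,6,9,11,17,18,19,22,27,33,34,38,41,43}», `2 ≤ c ≤ 48`): `c` is primitively
represented by `x² + 2y²` exactly for the listed `c` (`x ≤ 6`, `y ≤ 4`). [kernel, `decide`] -/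
theorem lineTable_two :
    ∀ c ∈ Finset.Icc 2 48,
      (c ∈ ({2, 3, 6, 9, 11, 17, 18, 19, 22, 27, 33, 34, 38, 41, 43} : Finset ℕ) ↔
        ∃ x ∈ Finset.range 7, ∃ y ∈ Finset.range 5, x ^ 2 + 2 * y ^ 2 = c ∧ Nat.gcd x y = 1) := by
  decide

/-- **Line table for `ℚ(√−7)`, `ℤ[√−7]`-seed** (card §4: «`ℚ(√−7)` {7,8,11,16,23,29,32,37,43}», `2 ≤ c ≤ 48`): `c` is primitively
represented by `x² + 7y²` exactly for the listed `c` (`x ≤ 6`, `y ≤ 2`). [kernel, `decide`] -/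
theorem lineTable_seven :
    ∀ c ∈ Finset.Icc 2 48,
      (c ∈ ({7, 8, 11, 16, 23, 29, 32, 37, 43} : Finset ℕ) ↔
        ∃ x ∈ Finset.range 7, ∃ y ∈ Finset.range 3, x ^ 2 + 7 * y ^ 2 = c ∧ Nat.gcd x y = 1) := by
  decide

/-- The bounded search IS complete: any representation `x² + n·y² = c` with `c ≤ 48`, `n ≥ 1` has `x ≤ 6` and `n·y² ≤ 48`. [kernel] -/
theorem repr_bounds (n c x y : ℕ) (hc : c ≤ 48) (h : x ^ 2 + n * y ^ 2 = c) : x ≤ 6 ∧ n * y ^ 2 ≤ 48 := by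
  constructor
  · by_contra hx
    push Not at hx
    have : 49 ≤ x ^ 2 := by nlinarith
    omega
  · omega

end Summit.Ventures.HSemireg.LineDiophantine
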